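import Mathlib
import HarnessLib
import Summits.ValiantsHypothesis.ValiantsHypothesis.Theorems.LacunarySymmetroidMatrixDescartesOsculationLawGPGenericSeparable

/-!
# ValiantsHypothesis / LacunarySymmetroid — crux `MatrixDescartes` (stmt-ValiantsHypothesis-18050, V1),
# line «osculation-law», `stub_recursion` ROUTE′ density: the GENERIC DIAGONAL WITNESS (existential)

The density proof of ROUTE′ (val-port-3 g1's hereditary family `N′`, bus 2026-08-28 l.≈8186/8192) transports each
Zariski condition along the segment `S_ε = (1 − ε)S + εW` from ONE witness pencil `W`; the separability-type
conditions ((s): «`det G^{(j)}` separable at every level `j`», and p7 g13's (a2)) cannot be certified at the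
proportional diagonal witness (`det = h^m`).  This file provides the witness EXISTENTIALLY: diagonal letters
`W_l = −diag(σ_{l,1}, …, σ_{l,m})` with POSITIVE entries `σ` chosen as a common non-root of finitely many explicit
nonzero polynomials in the entries.

* (W1) `exists_pos_forall_eval_ne_zero(_finset)` — finitely many nonzero real `MvPolynomial`s have a common non-root in
  the open positive orthant (`MvPolynomial.funext_set` on the box `(0,∞)^σ`);
* (W2a) `separable_prod_one_add_C_mul_X_pow` — the binomial point `Π_i (1 + (i+1) t^D)` is separable (explicit Bézout);
* (W2b) `genericDisc_ne_zero` — the level discriminant `Res_t(F, F′)` of the GENERIC diagonal product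
  `F = Π_i Σ_{l<j} σ_{l,i} t^{d_l}` (base ring `MvPolynomial` in the entries) is a NONZERO polynomial;
* (W3) ★ `exists_generic_diagonal_witness(')` — positive entries `σ`, distinct within every letter, off any finite
  family `extra` of nonzero polynomials, with the diagonal product separable of full degree `m·d_{j−1}` at EVERY
  level `2 ≤ j ≤ K` (the `hsep`/`hdeg` input of `finite_bad_eps_separable'` at `ε₁ = 1`; `extra` = room for the
  other seats' certificates).

Honest framing: helper layer (witness side of an UNREGISTERED density stub of a V1 law line); `stub_recursion`, the
LAW `stub_osculationLaw`, `MatrixDescartes`, Conjecture B and `VP ≠ VNP` are OPEN / NOT proved.  No definitions, no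
named facts; Mathlib + `…GPGenericSeparable`.
-/

-- `Summit.ValiantsHypothesis.ValiantsHypothesis.…` is the tree's mandated single-conjunct layout (Sub = Summit).
set_option linter.dupNamespace false

noncomputable section

namespace Summit.ValiantsHypothesis.ValiantsHypothesis.Theorems.LacunarySymmetroidMatrixDescartes

namespace OsculationGeneric

open Polynomial
open scoped BigOperators

/-! ### (W1) Nonzero polynomials miss a point of the positive orthant -/

/-- A nonzero real polynomial in any set of variables has a non-root with ALL coordinates positive. [folklore] -/
theorem exists_pos_eval_ne_zero {τ : Type*} (P : MvPolynomial τ ℝ) (hP : P ≠ 0) :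
    ∃ x : τ → ℝ, (∀ i, 0 < x i) ∧ MvPolynomial.eval x P ≠ 0 := by
  by_contra h
  push Not at h
  apply hP
  refine MvPolynomial.funext_set (fun _ => Set.Ioi (0 : ℝ)) (fun _ => Set.Ioi_infinite 0) fun x hx => ?_
  rw [map_zero]
  exact h x fun i => hx i (Set.mem_univ i)

/-- A finite family of nonzero real polynomials has a COMMON non-root with all coordinates positive. [folklore] -/
theorem exists_pos_forall_eval_ne_zero {τ ι : Type*} (s : Finset ι) (P : ι → MvPolynomial τ ℝ)
    (hP : ∀ i ∈ s, P i ≠ 0) :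
    ∃ x : τ → ℝ, (∀ i, 0 < x i) ∧ ∀ i ∈ s, MvPolynomial.eval x (P i) ≠ 0 := by
  classical
  obtain ⟨x, hx, hne⟩ := exists_pos_eval_ne_zero (∏ i ∈ s, P i) (Finset.prod_ne_zero_iff.2 hP)
  rw [map_prod] at hne
  exact ⟨x, hx, fun i hi => Finset.prod_ne_zero_iff.1 hne i hi⟩

/-- The same for a finite SET of nonzero polynomials. [folklore] -/
theorem exists_pos_forall_eval_ne_zero_finset {τ : Type*} (E : Finset (MvPolynomial τ ℝ)) (hE : ∀ Q ∈ E, Q ≠ 0) :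
    ∃ x : τ → ℝ, (∀ i, 0 < x i) ∧ ∀ Q ∈ E, MvPolynomial.eval x Q ≠ 0 :=
  exists_pos_forall_eval_ne_zero E id hE

/-! ### (W2a) The binomial evaluation point is separable — explicit Bézout identities -/

/-- `1 + μ t^D` is separable for `D ≥ 1` (explicit Bézout: `(1 + μt^D) − (t/D)·(μ D t^{D−1}) = 1`). [folklore] -/
theorem separable_one_add_C_mul_X_pow (μ : ℝ) {D : ℕ} (hD : 1 ≤ D) :
    (1 + C μ * X ^ D : ℝ[X]).Separable := by
  rw [separable_def, derivative_add, derivative_one, zero_add, derivative_C_mul_X_pow]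
  refine ⟨1, -(C (1 / (D : ℝ)) * X), ?_⟩
  obtain ⟨D', rfl⟩ : ∃ D', D = D' + 1 := ⟨D - 1, by omega⟩
  have hD0 : ((D' + 1 : ℕ) : ℝ) ≠ 0 := by positivity
  simp only [Nat.add_sub_cancel]
  have : C (1 / ((D' + 1 : ℕ) : ℝ)) * X * (C (μ * ((D' + 1 : ℕ) : ℝ)) * X ^ D') = C μ * X ^ (D' + 1) := by
    rw [show C (μ * ((D' + 1 : ℕ) : ℝ)) = C μ * C (((D' + 1 : ℕ) : ℝ)) from C_mul, pow_succ]
    have hc : C (1 / ((D' + 1 : ℕ) : ℝ)) * C (((D' + 1 : ℕ) : ℝ)) = (1 : ℝ[X]) := by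
      rw [← C_mul, div_mul_cancel₀ _ hD0, C_1]
    calc C (1 / ((D' + 1 : ℕ) : ℝ)) * X * (C μ * C (((D' + 1 : ℕ) : ℝ)) * X ^ D')
        = (C (1 / ((D' + 1 : ℕ) : ℝ)) * C (((D' + 1 : ℕ) : ℝ))) * C μ * (X ^ D' * X) := by ring
      _ = C μ * (X ^ D' * X) := by rw [hc, one_mul]
  linear_combination (-1 : ℝ[X]) * this

/-- `1 + μ t^D` and `1 + μ′ t^D` are coprime for `μ ≠ μ′` (Bézout: `μ′(1+μt^D) − μ(1+μ′t^D) = μ′ − μ`). [folklore] -/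
theorem isCoprime_one_add_C_mul_X_pow {μ μ' : ℝ} (h : μ ≠ μ') (D : ℕ) :
    IsCoprime (1 + C μ * X ^ D : ℝ[X]) (1 + C μ' * X ^ D) := by
  have hne : μ' - μ ≠ 0 := sub_ne_zero.2 (Ne.symm h)
  refine ⟨C (μ' / (μ' - μ)), C (-(μ / (μ' - μ))), ?_⟩
  have key : C (μ' / (μ' - μ)) * (1 + C μ * X ^ D) + C (-(μ / (μ' - μ))) * (1 + C μ' * X ^ D) =
      C (μ' / (μ' - μ) - μ / (μ' - μ)) + C (μ' / (μ' - μ) * μ - μ / (μ' - μ) * μ') * X ^ D := by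
    simp only [map_sub, map_mul, map_neg]
    ring
  rw [key, show μ' / (μ' - μ) * μ - μ / (μ' - μ) * μ' = 0 by ring, map_zero, zero_mul, add_zero,
    show μ' / (μ' - μ) - μ / (μ' - μ) = 1 by field_simp, C_1]

/-- The binomial point: `Π_{i<m} (1 + (i+1) t^D)` is separable (`D ≥ 1`). [folklore] -/
theorem separable_prod_one_add_C_mul_X_pow (m : ℕ) {D : ℕ} (hD : 1 ≤ D) :
    (∏ i : Fin m, (1 + C ((i : ℝ) + 1) * X ^ D : ℝ[X])).Separable := by
  refine separable_prod' (fun i _ j _ hij => isCoprime_one_add_C_mul_X_pow ?_ D)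
    (fun i _ => separable_one_add_C_mul_X_pow _ hD)
  intro h
  apply hij
  have h' : ((i : ℕ) : ℝ) = ((j : ℕ) : ℝ) := add_right_cancel h
  exact Fin.ext (Nat.cast_inj.1 h')


/-! ### (W2b) The generic diagonal product at one level: base change and the binomial point -/

section Level

variable {m K : ℕ} (d : Fin K → ℕ) {j : ℕ} (hj : j ≤ K)

/-- Base change for the level product `Π_i Σ_{l<j} C(σ(l,i)) t^{d l}` (any ring map). [folklore] -/
theorem map_levelProd {R S : Type*} [CommRing R] [CommRing S] (φ : R →+* S) (σv : Fin K × Fin m → R) :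
    (∏ i : Fin m, ∑ l : Fin j, C (σv (Fin.castLE hj l, i)) * (X : R[X]) ^ d (Fin.castLE hj l)).map φ =
      ∏ i : Fin m, ∑ l : Fin j, C (φ (σv (Fin.castLE hj l, i))) * (X : S[X]) ^ d (Fin.castLE hj l) := by
  simp [Polynomial.map_prod, Polynomial.map_sum, Polynomial.map_mul, Polynomial.map_pow, map_C, map_X]

/-- The GENERIC level product (entries = the variables of `MvPolynomial (Fin K × Fin m) ℝ`) specialises at `σ` to
the real level product. [folklore] -/
theorem map_genericLevelProd (σ : Fin K × Fin m → ℝ) :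
    (∏ i : Fin m, ∑ l : Fin j, C (MvPolynomial.X (Fin.castLE hj l, i)) *
        (X : (MvPolynomial (Fin K × Fin m) ℝ)[X]) ^ d (Fin.castLE hj l)).map (MvPolynomial.eval σ) =
      ∏ i : Fin m, ∑ l : Fin j, C (σ (Fin.castLE hj l, i)) * (X : ℝ[X]) ^ d (Fin.castLE hj l) := by
  rw [map_levelProd]
  simp only [MvPolynomial.eval_X]

/-- Each diagonal fewnomial has degree at most the top exponent. [folklore] -/
theorem natDegree_levelFactor_le (σ : Fin K × Fin m → ℝ) (i : Fin m) (D : ℕ)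
    (hD : ∀ l : Fin j, d (Fin.castLE hj l) ≤ D) :
    (∑ l : Fin j, C (σ (Fin.castLE hj l, i)) * (X : ℝ[X]) ^ d (Fin.castLE hj l)).natDegree ≤ D :=
  natDegree_sum_le_of_forall_le _ _ fun l _ => (natDegree_C_mul_X_pow_le _ _).trans (hD l)

/-- The coefficient of the top exponent `D = d_{j−1}` in a diagonal fewnomial is the top entry, when the top
exponent is attained only at the last index. [folklore] -/
theorem coeff_levelFactor_top (σ : Fin K × Fin m → ℝ) (i : Fin m) (hj2 : 1 ≤ j)
    (htop : ∀ l : Fin j, (l : ℕ) + 1 < j → d (Fin.castLE hj l) < d (Fin.castLE hj ⟨j - 1, by omega⟩)) :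
    (∑ l : Fin j, C (σ (Fin.castLE hj l, i)) * (X : ℝ[X]) ^ d (Fin.castLE hj l)).coeff
        (d (Fin.castLE hj ⟨j - 1, by omega⟩)) = σ (Fin.castLE hj ⟨j - 1, by omega⟩, i) := by
  classical
  rw [finsetSum_coeff]
  simp only [coeff_C_mul_X_pow]
  rw [Finset.sum_eq_single ⟨j - 1, by omega⟩]
  · rw [if_pos rfl]
  · intro l _ hl
    rw [if_neg]
    intro h
    have hlt : (l : ℕ) + 1 < j := by
      have h1 : (l : ℕ) ≠ j - 1 := fun e => hl (Fin.ext e)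
      have h2 := l.isLt
      omega
    exact absurd h (ne_of_gt (htop l hlt))
  · intro h; exact absurd (Finset.mem_univ _) h

/-- With nonzero top entries the real level product has full degree `m · d_{j−1}`. [folklore] -/
theorem natDegree_levelProd (σ : Fin K × Fin m → ℝ) (hj2 : 1 ≤ j)
    (htop : ∀ l : Fin j, (l : ℕ) + 1 < j → d (Fin.castLE hj l) < d (Fin.castLE hj ⟨j - 1, by omega⟩))
    (hσ : ∀ i, σ (Fin.castLE hj ⟨j - 1, by omega⟩, i) ≠ 0) :
    (∏ i : Fin m, ∑ l : Fin j, C (σ (Fin.castLE hj l, i)) * (X : ℝ[X]) ^ d (Fin.castLE hj l)).natDegree =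
      m * d (Fin.castLE hj ⟨j - 1, by omega⟩) := by
  classical
  set D := d (Fin.castLE hj ⟨j - 1, by omega⟩) with hDdef
  have hle : ∀ l : Fin j, d (Fin.castLE hj l) ≤ D := by
    intro l
    by_cases h : (l : ℕ) + 1 < j
    · exact (htop l h).le
    · have : l = ⟨j - 1, by omega⟩ := Fin.ext (show (l : ℕ) = j - 1 by have := l.isLt; omega)
      rw [this]
  have hdeg : ∀ i, (∑ l : Fin j, C (σ (Fin.castLE hj l, i)) * (X : ℝ[X]) ^ d (Fin.castLE hj l)).natDegree = D := by
    intro i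
    refine le_antisymm (natDegree_levelFactor_le d hj σ i D hle) (le_natDegree_of_ne_zero ?_)
    rw [coeff_levelFactor_top d hj σ i hj2 htop]
    exact hσ i
  have hne : ∀ i, (∑ l : Fin j, C (σ (Fin.castLE hj l, i)) * (X : ℝ[X]) ^ d (Fin.castLE hj l)) ≠ 0 := by
    intro i h0
    have := congr_arg (fun p : ℝ[X] => p.coeff D) h0
    simp only [coeff_zero] at this
    rw [coeff_levelFactor_top d hj σ i hj2 htop] at this
    exact hσ i this
  rw [natDegree_prod _ _ fun i _ => hne i]
  simp only [hdeg, Finset.sum_const, Finset.card_univ, Fintype.card_fin, smul_eq_mul]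

/-- The BINOMIAL POINT, by values: entries `1` on the first letter, `i+1` on the last one, `0` elsewhere give the
level product `Π_i (1 + (i+1) t^D)` when the support is in normal form (`d_0 = 0`, `j ≥ 2`). [folklore] -/
theorem levelProd_of_binomial_values (σ : Fin K × Fin m → ℝ) (hj2 : 2 ≤ j)
    (hd0 : d (Fin.castLE hj ⟨0, by omega⟩) = 0)
    (h0 : ∀ i, σ (Fin.castLE hj ⟨0, by omega⟩, i) = 1)
    (h1 : ∀ i : Fin m, σ (Fin.castLE hj ⟨j - 1, by omega⟩, i) = (i : ℝ) + 1)
    (h2 : ∀ i (l : Fin j), (l : ℕ) ≠ 0 → (l : ℕ) + 1 ≠ j → σ (Fin.castLE hj l, i) = 0) :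
    (∏ i : Fin m, ∑ l : Fin j, C (σ (Fin.castLE hj l, i)) * (X : ℝ[X]) ^ d (Fin.castLE hj l)) =
      ∏ i : Fin m, (1 + C ((i : ℝ) + 1) * X ^ d (Fin.castLE hj ⟨j - 1, by omega⟩)) := by
  classical
  refine Finset.prod_congr rfl fun i _ => ?_
  have h01 : (⟨0, by omega⟩ : Fin j) ≠ ⟨j - 1, by omega⟩ := by
    intro h; have := congr_arg Fin.val h; simp at this; omega
  rw [← Finset.sum_subset (Finset.subset_univ ({⟨0, by omega⟩, ⟨j - 1, by omega⟩} : Finset (Fin j)))]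
  · rw [Finset.sum_pair h01, h0 i, h1 i, hd0, pow_zero, mul_one, map_one]
  · intro l _ hl
    rw [Finset.mem_insert, Finset.mem_singleton, not_or] at hl
    have hl0 : (l : ℕ) ≠ 0 := fun e => hl.1 (Fin.ext e)
    have hl1 : (l : ℕ) + 1 ≠ j := by
      intro e; apply hl.2; exact Fin.ext (show (l : ℕ) = j - 1 by omega)
    rw [h2 i l hl0 hl1, map_zero, zero_mul]

/-- **(W2b) The generic level discriminant is a nonzero polynomial in the entries.**  `Q_j := Res_t(F_j, F_j′)`
at formal degrees `(mD, mD − 1)`, `F_j` the generic diagonal product at level `j` (`2 ≤ j ≤ K`, support in normal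
form on the truncation), does not vanish identically: at the binomial point it is the resultant of a separable
polynomial of full degree. [folklore] -/
theorem genericDisc_ne_zero (hj2 : 2 ≤ j) (hd0 : d (Fin.castLE hj ⟨0, by omega⟩) = 0)
    (htop : ∀ l : Fin j, (l : ℕ) + 1 < j → d (Fin.castLE hj l) < d (Fin.castLE hj ⟨j - 1, by omega⟩)) :
    resultant
        (∏ i : Fin m, ∑ l : Fin j, C (MvPolynomial.X (Fin.castLE hj l, i)) *
          (X : (MvPolynomial (Fin K × Fin m) ℝ)[X]) ^ d (Fin.castLE hj l))
        (derivative (∏ i : Fin m, ∑ l : Fin j, C (MvPolynomial.X (Fin.castLE hj l, i)) *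
          (X : (MvPolynomial (Fin K × Fin m) ℝ)[X]) ^ d (Fin.castLE hj l)))
        (m * d (Fin.castLE hj ⟨j - 1, by omega⟩)) (m * d (Fin.castLE hj ⟨j - 1, by omega⟩) - 1) ≠ 0 := by
  classical
  set D := d (Fin.castLE hj ⟨j - 1, by omega⟩) with hDdef
  have hD : 1 ≤ D := by
    have := htop ⟨0, by omega⟩ (by simp; omega)
    rw [hd0] at this
    omega
  -- the binomial point (conditions on the ℕ-value of the letter index)
  set σ₀ : Fin K × Fin m → ℝ := fun p => if (p.1 : ℕ) = 0 then (1 : ℝ)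
      else if (p.1 : ℕ) + 1 = j then (p.2 : ℝ) + 1 else 0 with hσ₀
  have e0 : ∀ i, σ₀ (Fin.castLE hj ⟨0, by omega⟩, i) = 1 := fun i => by simp [hσ₀]
  have e1 : ∀ i : Fin m, σ₀ (Fin.castLE hj ⟨j - 1, by omega⟩, i) = (i : ℝ) + 1 := fun i => by
    have hj0 : j - 1 ≠ 0 := by omega
    have hj1 : j - 1 + 1 = j := by omega
    simp [hσ₀, hj0, hj1]
  have e2 : ∀ i (l : Fin j), (l : ℕ) ≠ 0 → (l : ℕ) + 1 ≠ j → σ₀ (Fin.castLE hj l, i) = 0 := fun i l hl0 hl1 => by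
    simp [hσ₀, hl0, hl1]
  intro h0
  have h1 := congr_arg (MvPolynomial.eval σ₀) h0
  rw [map_zero, ← resultant_map_map, ← derivative_map, map_genericLevelProd,
    levelProd_of_binomial_values d hj σ₀ hj2 hd0 e0 e1 e2] at h1
  -- degree and separability of the binomial product
  have hsep := separable_prod_one_add_C_mul_X_pow m hD (D := D)
  have hdeg : (∏ i : Fin m, (1 + C ((i : ℝ) + 1) * X ^ D : ℝ[X])).natDegree = m * D := by
    have hf : ∀ i : Fin m, (1 + C ((i : ℝ) + 1) * X ^ D : ℝ[X]).natDegree = D := by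
      intro i
      have hc : (i : ℝ) + 1 ≠ 0 := by positivity
      have hq : (C ((i : ℝ) + 1) * X ^ D : ℝ[X]).natDegree = D := natDegree_C_mul_X_pow D _ hc
      rw [natDegree_add_eq_right_of_natDegree_lt (by rw [hq, natDegree_one]; exact hD), hq]
    have hne : ∀ i : Fin m, (1 + C ((i : ℝ) + 1) * X ^ D : ℝ[X]) ≠ 0 :=
      fun i => (separable_one_add_C_mul_X_pow _ hD).ne_zero
    rw [natDegree_prod _ _ fun i _ => hne i, Finset.sum_congr rfl fun i _ => hf i, Finset.sum_const,
      Finset.card_univ, Fintype.card_fin, smul_eq_mul]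
  exact (resultant_derivative_ne_zero_iff hdeg hsep.ne_zero).2 hsep h1

end Level

/-! ### Factors of a separable product -/

/-- In a separable finite product every factor is separable and distinct factors are coprime. [folklore] -/
theorem separable_and_isCoprime_of_prod {ι : Type*} [Fintype ι] [DecidableEq ι] (f : ι → ℝ[X])
    (h : (∏ i, f i).Separable) :
    (∀ i, (f i).Separable) ∧ ∀ i i', i ≠ i' → IsCoprime (f i) (f i') := by
  refine ⟨fun i => h.of_dvd (Finset.dvd_prod_of_mem f (Finset.mem_univ i)), fun i i' hii' => ?_⟩
  have hdvd : f i * f i' ∣ ∏ k, f k := by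
    rw [← Finset.prod_pair hii']
    exact Finset.prod_dvd_prod_of_subset _ _ _ (Finset.subset_univ _)
  exact (h.of_dvd hdvd).isCoprime

/-! ### (W3) The existential generic diagonal witness -/

/-- **Generic diagonal witness, all levels at once.**  For a support `d : Fin K → ℕ` in normal form (`d 0 = 0`,
strictly increasing) and ANY finite family `extra` of nonzero polynomials in the entries, there are POSITIVE entries
`σ` off every member of `extra` such that at EVERY level `2 ≤ j ≤ K` the diagonal product
`Π_i Σ_{l<j} σ(l,i) t^{d l}` has full degree `m·d_{j−1}` and is SEPARABLE. [folklore] -/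
theorem exists_generic_diagonal_witness (m K : ℕ) (d : Fin K → ℕ) (hd : StrictMono d)
    (hd0 : ∀ h : 0 < K, d ⟨0, h⟩ = 0) (extra : Finset (MvPolynomial (Fin K × Fin m) ℝ))
    (hextra : ∀ Q ∈ extra, Q ≠ 0) :
    ∃ σ : Fin K × Fin m → ℝ, (∀ p, 0 < σ p) ∧ (∀ Q ∈ extra, MvPolynomial.eval σ Q ≠ 0) ∧
      (∀ (l : Fin K) (i i' : Fin m), i ≠ i' → σ (l, i) ≠ σ (l, i')) ∧
      ∀ (j : ℕ) (hj : j ≤ K) (hj2 : 2 ≤ j),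
        (∏ i : Fin m, ∑ l : Fin j, C (σ (Fin.castLE hj l, i)) * (X : ℝ[X]) ^ d (Fin.castLE hj l)).natDegree =
            m * d (Fin.castLE hj ⟨j - 1, by omega⟩) ∧
        (∏ i : Fin m, ∑ l : Fin j, C (σ (Fin.castLE hj l, i)) * (X : ℝ[X]) ^ d (Fin.castLE hj l)).Separable := by
  classical
  -- normal form on every truncation
  have hd0' : ∀ (j : ℕ) (hj : j ≤ K) (hj2 : 2 ≤ j), d (Fin.castLE hj ⟨0, by omega⟩) = 0 := fun j hj hj2 =>
    hd0 (lt_of_lt_of_le (by norm_num) (hj2.trans hj))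
  have htop' : ∀ (j : ℕ) (hj : j ≤ K) (hj2 : 2 ≤ j), ∀ l : Fin j, (l : ℕ) + 1 < j →
      d (Fin.castLE hj l) < d (Fin.castLE hj ⟨j - 1, by omega⟩) := by
    intro j hj hj2 l hl
    apply hd
    rw [Fin.lt_def]
    simp only [Fin.val_castLE]
    omega
  -- the level discriminants as a function of the level (trivial outside `[2, K]`)
  set Qlev : ℕ → MvPolynomial (Fin K × Fin m) ℝ := fun jj =>
    if hjj : jj ≤ K then
      if hjj2 : 2 ≤ jj then
        resultant
          (∏ i : Fin m, ∑ l : Fin jj, C (MvPolynomial.X (Fin.castLE hjj l, i)) *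
            (X : (MvPolynomial (Fin K × Fin m) ℝ)[X]) ^ d (Fin.castLE hjj l))
          (derivative (∏ i : Fin m, ∑ l : Fin jj, C (MvPolynomial.X (Fin.castLE hjj l, i)) *
            (X : (MvPolynomial (Fin K × Fin m) ℝ)[X]) ^ d (Fin.castLE hjj l)))
          (m * d (Fin.castLE hjj ⟨jj - 1, by omega⟩)) (m * d (Fin.castLE hjj ⟨jj - 1, by omega⟩) - 1)
      else 1
    else 1 with hQlev
  have hQlev_ne : ∀ jj, Qlev jj ≠ 0 := by
    intro jj
    simp only [hQlev]
    split_ifs with hjj hjj2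
    · exact genericDisc_ne_zero d hjj hjj2 (hd0' _ hjj hjj2) (htop' _ hjj hjj2)
    · exact one_ne_zero
    · exact one_ne_zero
  -- distinct entries within each letter (rows injective): avoid `X(l,i) − X(l,i')`
  set Qrow : Finset (MvPolynomial (Fin K × Fin m) ℝ) :=
    ((Finset.univ : Finset (Fin K × Fin m × Fin m)).filter (fun q => q.2.1 ≠ q.2.2)).image
      (fun q => MvPolynomial.X (q.1, q.2.1) - MvPolynomial.X (q.1, q.2.2)) with hQrow
  have hQrow_ne : ∀ Q ∈ Qrow, Q ≠ 0 := by
    intro Q hQ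
    rw [hQrow, Finset.mem_image] at hQ
    obtain ⟨q, hq, rfl⟩ := hQ
    rw [Finset.mem_filter] at hq
    intro h0
    have h := congr_arg (MvPolynomial.eval (fun p : Fin K × Fin m => if p.2 = q.2.1 then (1 : ℝ) else 0)) h0
    simp only [map_sub, MvPolynomial.eval_X, map_zero, if_neg (Ne.symm hq.2)] at h
    norm_num at h
  set Qs : Finset (MvPolynomial (Fin K × Fin m) ℝ) := (extra ∪ Qrow) ∪ (Finset.range (K + 1)).image Qlev
    with hQs
  have hQs_ne : ∀ Q ∈ Qs, Q ≠ 0 := by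
    intro Q hQ
    rw [hQs, Finset.mem_union, Finset.mem_union] at hQ
    rcases hQ with (hQ | hQ) | hQ
    · exact hextra Q hQ
    · exact hQrow_ne Q hQ
    · rw [Finset.mem_image] at hQ
      obtain ⟨jj, _, rfl⟩ := hQ
      exact hQlev_ne jj
  obtain ⟨σ, hpos, hgood⟩ := exists_pos_forall_eval_ne_zero_finset Qs hQs_ne
  have hextra' : ∀ Q ∈ extra, MvPolynomial.eval σ Q ≠ 0 := fun Q hQ =>
    hgood Q (by rw [hQs]; exact Finset.mem_union_left _ (Finset.mem_union_left _ hQ))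
  refine ⟨σ, hpos, hextra', ?_, ?_⟩
  · intro l i i' hii' heq
    have hmem : MvPolynomial.X (l, i) - MvPolynomial.X (l, i') ∈ Qs := by
      rw [hQs]
      refine Finset.mem_union_left _ (Finset.mem_union_right _ ?_)
      rw [hQrow, Finset.mem_image]
      exact ⟨(l, i, i'), Finset.mem_filter.2 ⟨Finset.mem_univ _, hii'⟩, rfl⟩
    have h := hgood _ hmem
    simp only [map_sub, MvPolynomial.eval_X, heq, sub_self] at h
    exact h rfl
  intro j hj hj2
  have hdeg := natDegree_levelProd d hj σ (by omega) (htop' j hj hj2) (fun i => (hpos _).ne')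
  refine ⟨hdeg, ?_⟩
  -- the level discriminant does not vanish at `σ`
  have hmem : Qlev j ∈ Qs := by
    rw [hQs]
    exact Finset.mem_union_right _ (Finset.mem_image.2 ⟨j, Finset.mem_range.2 (by omega), rfl⟩)
  have hres := hgood _ hmem
  simp only [hQlev, dif_pos hj, dif_pos hj2] at hres
  rw [← resultant_map_map, ← derivative_map, map_genericLevelProd] at hres
  have hne : (∏ i : Fin m, ∑ l : Fin j, C (σ (Fin.castLE hj l, i)) * (X : ℝ[X]) ^ d (Fin.castLE hj l)) ≠ 0 := by
    rw [← natDegree_levelProd d hj σ (by omega) (htop' j hj hj2) (fun i => (hpos _).ne')] at hdeg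
    intro h0
    have hD : 1 ≤ d (Fin.castLE hj ⟨j - 1, by omega⟩) := by
      have := htop' j hj hj2 ⟨0, by omega⟩ (by simp; omega)
      rw [hd0' j hj hj2] at this; omega
    -- each factor is nonzero (its top coefficient is positive), so the product is nonzero
    refine absurd h0 (Finset.prod_ne_zero_iff.2 fun i _ h0i => ?_)
    have := congr_arg (fun p : ℝ[X] => p.coeff (d (Fin.castLE hj ⟨j - 1, by omega⟩))) h0i
    simp only [coeff_zero] at this
    rw [coeff_levelFactor_top d hj σ i (by omega) (htop' j hj hj2)] at this
    exact (hpos _).ne' this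
  exact (resultant_derivative_ne_zero_iff hdeg hne).1 hres

/-- **Generic diagonal witness, letter-first curried form** (`σ l i`, the binder shape of val-lit-p4 g13's
`node_certificates`). [folklore] -/
theorem exists_generic_diagonal_witness' (m K : ℕ) (d : Fin K → ℕ) (hd : StrictMono d)
    (hd0 : ∀ h : 0 < K, d ⟨0, h⟩ = 0) (extra : Finset (MvPolynomial (Fin K × Fin m) ℝ))
    (hextra : ∀ Q ∈ extra, Q ≠ 0) :
    ∃ σ : Fin K → Fin m → ℝ, (∀ l i, 0 < σ l i) ∧ (∀ Q ∈ extra, MvPolynomial.eval (fun p => σ p.1 p.2) Q ≠ 0) ∧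
      (∀ l i j, i ≠ j → σ l i ≠ σ l j) ∧
      ∀ (j : ℕ) (hj : j ≤ K) (hj2 : 2 ≤ j),
        (∏ i : Fin m, ∑ l : Fin j, C (σ (Fin.castLE hj l) i) * (X : ℝ[X]) ^ d (Fin.castLE hj l)).natDegree =
            m * d (Fin.castLE hj ⟨j - 1, by omega⟩) ∧
        (∏ i : Fin m, ∑ l : Fin j, C (σ (Fin.castLE hj l) i) * (X : ℝ[X]) ^ d (Fin.castLE hj l)).Separable := by
  obtain ⟨σ, hpos, hex, hrow, hlev⟩ := exists_generic_diagonal_witness m K d hd hd0 extra hextra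
  exact ⟨fun l i => σ (l, i), fun l i => hpos _, hex, fun l i j h => hrow l i j h, hlev⟩

end OsculationGeneric

end Summit.ValiantsHypothesis.ValiantsHypothesis.Theorems.LacunarySymmetroidMatrixDescartes
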